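import Literature.MathematicalPhysics.KineticTheory.HardSphereEulerProofs
import HarnessLib

/-!
# The `t = 0` LLN caps the conserved energy (stub `energyCap`)

Supporting file of the line `Sketch` (card `adiabat-pricing-of-the-ceiling`) for the crux
`AprioriBounds` (stmt-AtomisticToContinuum-14827, reshape r3 of the floor), proving the registered
stub `stub_energyCap` of the lead's skeleton VERBATIM: if the empirical fields of the local Gibbs
laws `P_N = localGibbsLaw σ a₀ u₀ θ₀ N (Φ N)` at time `0` converge in probability to those of
`(ρ, u, θ)(0, ·)` (`TendstoHydroFieldsAt … ρ u θ 0`, `HardSphereEuler.lean`), then with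
`K := |∫ x, E(0, x) dx| + 1 ≥ 0`, `E(0, x) = totalEnergyDensity (ρ 0 x) (u 0 x) (θ 0 x)`,
the event "`z` is not a good initial datum of `Φ N`, or its kinetic energy exceeds `K (N + 1)`"
has `P_N`-probability tending to `0`.

## Proof

The third conjunct of the LLN hypothesis at the constant test function `χ ≡ 1` with `δ = 1`
says `P_N {z | 1 < |empiricalEnergyField (Φ_0 z) 1 − ∫ E(0)|} → 0`.  For `N + 1` particles
`empiricalEnergyField z 1 = E(z) / (N + 1)` (`empiricalEnergyField_eq_sum`), and on the good set
`Φ_0 z = z` (`HardSphereFlow.flow_zero`), so a good `z` with `K (N + 1) < E(z)` has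
`E(z)/(N+1) − ∫ E(0) > K − ∫ E(0) ≥ 1`.  The complement of the good set is `P_N`-null: the law is
the flow-free `localGibbsMeasure` (`localGibbsLaw_eq`), absolutely continuous with respect to the
Liouville measure (`localGibbsMeasure_absolutelyContinuous`), for which the good set is conull
(`HardSphereFlow.measure_compl_good`).  Hence `P_N(bad) ≤ P_N(goodᶜ) + P_N(deviation > 1)
= P_N(deviation > 1) → 0`.  No smallness of `σ`, no Euler solution, no normalisation of `P_N` is
used.

No new definitions, no named facts; two private arithmetic/measure helpers; axioms `propext`,
`Classical.choice`, `Quot.sound`.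
-/

noncomputable section

open MeasureTheory Filter Set Topology
open scoped ENNReal

namespace Summit.AtomisticToContinuum.HydrodynamicLimit.Theorems.AdiabatCeiling

open Literature.MathematicalPhysics.KineticTheory Literature.Analysis.FluidPDE

/-- Monotonicity of a measure along an inclusion that holds on a conull set `g`:
if `μ gᶜ = 0` and `s ∩ g ⊆ t`, then `μ s ≤ μ t`. -/
private theorem measure_le_of_subset_on {α : Type*} [MeasurableSpace α] {μ : Measure α}
    {g s t : Set α} (hg : μ gᶜ = 0) (h : ∀ x ∈ g, x ∈ s → x ∈ t) : μ s ≤ μ t :=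
  calc μ s ≤ μ (gᶜ ∪ t) := measure_mono fun x hx => by
          by_cases hxg : x ∈ g
          · exact Or.inr (h x hxg hx)
          · exact Or.inl hxg
    _ ≤ μ gᶜ + μ t := measure_union_le _ _
    _ = μ t := by rw [hg, zero_add]

/-- The arithmetic of the cap: if `(|I| + 1) n < e` with `n > 0` then `e / n` deviates from `I`
by more than `1`. -/
private theorem one_lt_abs_sub_of_cap {I e n : ℝ} (hn : 0 < n) (h : (|I| + 1) * n < e) :
    1 < |e / n - I| := by
  rw [← lt_div_iff₀ hn] at h
  calc (1 : ℝ) ≤ |I| + 1 - I := by linarith [le_abs_self I]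
    _ < e / n - I := by linarith
    _ ≤ |e / n - I| := le_abs_self _

/-- The empirical energy field of `N + 1` particles tested against `χ ≡ 1` is the kinetic energy
per particle `E(z) / (N + 1)`. -/
private theorem empiricalEnergyField_one_eq {N : ℕ} (z : Config (N + 1) (Fin 3) T3) :
    empiricalEnergyField z (fun _ => (1 : ℝ)) = configEnergy z / ((N : ℝ) + 1) := by
  rw [empiricalEnergyField_eq_sum, configEnergy, Finset.mul_sum, Finset.mul_sum, Finset.sum_div]
  push_cast
  exact Finset.sum_congr rfl fun i _ => by ring

/-- STUB `energyCap` of the line `Sketch` (crux `AprioriBounds`, stmt-AtomisticToContinuum-14827,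
reshape r3): the `t = 0` law of large numbers of the crux prefix, tested against `χ ≡ 1` with
`δ = 1`, caps the kinetic energy per particle.  With `K := |∫ x, E(0, x)| + 1 ≥ 0`,
`P_N {z ∉ good ∨ K (N + 1) < E(z)} → 0`: for `N + 1` particles
`empiricalEnergyField z 1 = E(z)/(N+1)` (`empiricalEnergyField_eq_sum`), `Φ_0 = id` on the good
set (`HardSphereFlow.flow_zero`), and the local Gibbs law is carried by the good set
(`localGibbsLaw_eq`, `localGibbsMeasure_absolutelyContinuous`, `HardSphereFlow.measure_compl_good`).
No smallness of `σ` and no Euler solution is needed. -/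
theorem stub_energyCap :
    ∀ (a₀ θ₀ : T3 → ℝ) (u₀ : T3 → V3) (σ : ℝ) (ρ θ : ℝ → T3 → ℝ) (u : ℝ → T3 → V3)
      (Φ : (N : ℕ) → HardSphereFlow (Torus.geometry (Fin 3)) (hsDiameter σ N) (N + 1)),
      TendstoHydroFieldsAt (fun N => localGibbsLaw σ a₀ u₀ θ₀ N (Φ N)) Φ ρ u θ 0 →
      ∃ K : ℝ, 0 ≤ K ∧ Tendsto (fun N : ℕ => localGibbsLaw σ a₀ u₀ θ₀ N (Φ N)
        {z | z ∉ (Φ N).good ∨ K * ((N : ℝ) + 1) < configEnergy z}) atTop (𝓝 0) := by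
  intro a₀ θ₀ u₀ σ ρ θ u Φ hLLN
  -- the energy clause of the `t = 0` LLN at `χ ≡ 1`, `δ = 1`
  have h := ((hLLN (fun _ => (1 : ℝ)) continuous_const) 1 one_pos).2.2
  refine ⟨|∫ x, (fun _ : T3 => (1 : ℝ)) x * totalEnergyDensity (ρ 0 x) (u 0 x) (θ 0 x)| + 1,
    by positivity, ?_⟩
  refine tendsto_of_tendsto_of_tendsto_of_le_of_le tendsto_const_nhds h (fun _ => zero_le)
    fun N => ?_
  -- `P_N` is carried by the good set
  have hg : localGibbsLaw σ a₀ u₀ θ₀ N (Φ N) (Φ N).goodᶜ = 0 := by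
    rw [localGibbsLaw_eq]
    exact localGibbsMeasure_absolutelyContinuous σ a₀ u₀ θ₀ N (Φ N) (Φ N).measure_compl_good
  refine measure_le_of_subset_on hg fun z hz hbad => ?_
  rcases hbad with hnot | hE
  · exact absurd hz hnot
  -- on the good set `Φ_0 z = z`, and the field at `χ ≡ 1` is `E(z)/(N+1) > K ≥ ∫ E(0) + 1`
  show 1 < |empiricalEnergyField ((Φ N).flow 0 z) (fun _ => (1 : ℝ)) -
    ∫ x, (fun _ : T3 => (1 : ℝ)) x * totalEnergyDensity (ρ 0 x) (u 0 x) (θ 0 x)|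
  rw [(Φ N).flow_zero z hz, empiricalEnergyField_one_eq]
  exact one_lt_abs_sub_of_cap (by positivity) hE

end Summit.AtomisticToContinuum.HydrodynamicLimit.Theorems.AdiabatCeiling

end
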